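import Literature.AlgebraicGeometry.Resolution.BlowupAlgebraPresentation
import Mathlib.RingTheory.RegularLocalRing.Polynomial
import HarnessLib

/-!
# The graph chart of the blow-up of the cone over `ℙ¹ × ℙ¹` is an affine `3`-space

Support file for crux stmt-ResolutionOfSingularities-15317 (`FrobeniusLadder.FRationalResolution`),
line `Sketch`, continuation seat c2, wave 2 (rung 4′ at the first singular members of the residual
class): stub `stub_chart_graph_prod` (worker U2). The threefold cone `T = {yz + x₁x₂ = 0} ⊂ 𝔸⁴`
(the cone over `ℙ¹ × ℙ¹`) is resolved by blowing up the origin `I = (x₁, x₂, y, z)`; by the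
symmetry of the relation one abstract chart statement covers all four charts. This file proves it:
for a `k`-algebra `R` generated by `x₁, x₂, y, z` with `yz + x₁x₂ = 0` and admitting the test map
`θ : R → k[Y, X₁', X₂'][1/Y]`, `θ y = Y`, `θ xᵢ = Xᵢ'Y`, `θ z = −X₁'X₂'Y`, the affine blowup algebra
`R[I/y] ⊆ R[1/y]` (`blowupAlgebra`, image model of `AffineBlowupAlgebra.lean`) is a regular ring —
indeed the chart parametrisation `ψ : k[Y, X₁', X₂'] → R[I/y]`, `Y ↦ y`, `Xᵢ' ↦ xᵢ/y`, is a ring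
isomorphism:

* `chartGraphProd_frac_z` — in `R[1/y]`, `z/y = −(x₁/y)(x₂/y)` (from `yz = −x₁x₂`);
* `chartGraphProd_algebraMap_mem` — a subring of `R[1/y]` containing `k`, `y`, `x₁/y`, `x₂/y`
  contains `R` (`R = k[x₁, x₂, y, z]`, `xᵢ = (xᵢ/y)·y`, `z = −(x₁/y)(x₂/y)·y`);
* `chartGraphProd_mem_of_mem_blowupAlgebra` — such a subring containing `R` contains `R[I/y]`
  (generated over `R` by the `r/y`, `r ∈ I`, and `r/y` is `R`-linear in `r`); so `ψ` is SURJECTIVE;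
* `chartGraphProd_injective` — `ψ` is INJECTIVE: `θ y = Y` is a unit of `k[Y, X'][1/Y]`, so `θ`
  extends to `θ' : R[1/y] → k[Y, X'][1/Y]` (`IsLocalization.Away.lift`) with `θ'(xᵢ/y) = Xᵢ'`, and
  `θ' ∘ ψ` is the (injective) localization map of the domain `k[Y, X₁', X₂']`;
* `stub_chart_graph_prod` — transport of the Mathlib instance `IsRegularRing (MvPolynomial (Fin 3) k)`
  along `RingEquiv.ofBijective ψ` (`IsRegularRing.of_ringEquiv`).

The hypothesis `hθz` of the registered signature is not used (it is forced by the other three values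
of `θ` and the relation). Only Mathlib's localization / `MvPolynomial` API and the tree's
`div_mem_blowupAlgebra`, `div_mul_algebraMap` are used; no named facts.
-/

-- single-problem summit: the doubled namespace component is forced
set_option linter.dupNamespace false

noncomputable section

open Literature.AlgebraicGeometry.Resolution

namespace Summit.ResolutionOfSingularities.ResolutionOfSingularities.Theorems.FRationalResolution

/-- **The relation on the `y`-chart**: if `yz + x₁x₂ = 0` in `R`, then in `R[1/y]`
`z/y = −(x₁/y)(x₂/y)` (multiply `yz = −x₁x₂` by `1/y²`). -/
theorem chartGraphProd_frac_z {R : Type*} [CommRing R] {x₁ x₂ y z : R}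
    (hrel : y * z + x₁ * x₂ = 0) :
    algebraMap R (Localization.Away y) z * IsLocalization.Away.invSelf y =
      -(algebraMap R (Localization.Away y) x₁ * IsLocalization.Away.invSelf y *
        (algebraMap R (Localization.Away y) x₂ * IsLocalization.Away.invSelf y)) := by
  have h1 := IsLocalization.Away.mul_invSelf (S := Localization.Away y) y
  have h2 : algebraMap R (Localization.Away y) y * algebraMap R (Localization.Away y) z +
      algebraMap R (Localization.Away y) x₁ * algebraMap R (Localization.Away y) x₂ = 0 := by
    rw [← map_mul, ← map_mul, ← map_add, hrel, map_zero]
  linear_combination IsLocalization.Away.invSelf y ^ 2 * h2 -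
    (algebraMap R (Localization.Away y) z * IsLocalization.Away.invSelf y) * h1

/-- **Generation of `R[I/y]`, `I = (x₁, x₂, y, z)`**: a subring `T ⊆ R[1/y]` containing the image
of `R` and the fractions `x₁/y`, `x₂/y` contains the affine blowup algebra `R[I/y]`. Indeed
`R[I/y]` is generated over `R` by the `r/y`, `r ∈ I`; the map `r ↦ r/y` is `R`-linear, and on the
generators of `I` its values `x₁/y`, `x₂/y`, `y/y = 1`, `z/y = −(x₁/y)(x₂/y)` lie in `T`. -/
theorem chartGraphProd_mem_of_mem_blowupAlgebra {R : Type*} [CommRing R] {x₁ x₂ y z : R}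
    (hrel : y * z + x₁ * x₂ = 0) (T : Subring (Localization.Away y))
    (hR : ∀ r, algebraMap R (Localization.Away y) r ∈ T)
    (h₁ : algebraMap R (Localization.Away y) x₁ * IsLocalization.Away.invSelf y ∈ T)
    (h₂ : algebraMap R (Localization.Away y) x₂ * IsLocalization.Away.invSelf y ∈ T)
    {w : Localization.Away y} (hw : w ∈ blowupAlgebra (Ideal.span {x₁, x₂, y, z}) y) : w ∈ T := by
  induction hw using Algebra.adjoin_induction with
  | mem w hw =>
    obtain ⟨r, hr, rfl⟩ := hw
    induction hr using Submodule.span_induction with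
    | mem r hr =>
      rcases hr with rfl | rfl | rfl | rfl
      · exact h₁
      · exact h₂
      · rw [IsLocalization.Away.mul_invSelf]
        exact T.one_mem
      · rw [chartGraphProd_frac_z hrel]
        exact T.neg_mem (T.mul_mem h₁ h₂)
    | zero =>
      rw [map_zero, zero_mul]
      exact T.zero_mem
    | add r s _ _ hr hs =>
      rw [map_add, add_mul]
      exact T.add_mem hr hs
    | smul c r _ hr =>
      rw [smul_eq_mul, map_mul, mul_assoc]
      exact T.mul_mem (hR c) hr
  | algebraMap r => exact hR r
  | add w₁ w₂ _ _ hw₁ hw₂ => exact T.add_mem hw₁ hw₂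
  | mul w₁ w₂ _ _ hw₁ hw₂ => exact T.mul_mem hw₁ hw₂

/-- **The image of `R` is reached**: if `R = k[x₁, x₂, y, z]` with `yz + x₁x₂ = 0`, a subring
`T ⊆ R[1/y]` containing the image of `k`, the element `y` and the fractions `x₁/y`, `x₂/y` contains
the image of `R`: `xᵢ = (xᵢ/y)·y`, `z = (z/y)·y = −(x₁/y)(x₂/y)·y`. -/
theorem chartGraphProd_algebraMap_mem {k R : Type*} [Field k] [CommRing R] [Algebra k R]
    {x₁ x₂ y z : R} (hrel : y * z + x₁ * x₂ = 0) (hgen : Algebra.adjoin k {x₁, x₂, y, z} = ⊤)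
    (T : Subring (Localization.Away y))
    (hC : ∀ c : k, algebraMap R (Localization.Away y) (algebraMap k R c) ∈ T)
    (hy : algebraMap R (Localization.Away y) y ∈ T)
    (h₁ : algebraMap R (Localization.Away y) x₁ * IsLocalization.Away.invSelf y ∈ T)
    (h₂ : algebraMap R (Localization.Away y) x₂ * IsLocalization.Away.invSelf y ∈ T) (r : R) :
    algebraMap R (Localization.Away y) r ∈ T := by
  have hr : r ∈ Algebra.adjoin k {x₁, x₂, y, z} := by
    rw [hgen]
    exact Algebra.mem_top
  induction hr using Algebra.adjoin_induction with
  | mem r hr =>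
    rcases hr with rfl | rfl | rfl | rfl
    · rw [← div_mul_algebraMap y r]
      exact T.mul_mem h₁ hy
    · rw [← div_mul_algebraMap y r]
      exact T.mul_mem h₂ hy
    · exact hy
    · rw [← div_mul_algebraMap y r, chartGraphProd_frac_z hrel]
      exact T.mul_mem (T.neg_mem (T.mul_mem h₁ h₂)) hy
  | algebraMap c => exact hC c
  | add r s _ _ hr hs =>
    rw [map_add]
    exact T.add_mem hr hs
  | mul r s _ _ hr hs =>
    rw [map_mul]
    exact T.mul_mem hr hs

/-- **Injectivity by the test map.** Let `θ : R → k[Y, X₁', X₂'][1/Y]` be a `k`-algebra map with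
`θ y = Y`, `θ x₁ = X₁'Y`, `θ x₂ = X₂'Y`, and let `φ : k[Y, X₁', X₂'] → R[1/y]` be a ring map with
`φ c = c`, `φ Y = y`, `φ Xᵢ' = xᵢ/y`. Then `φ` is injective: `θ y` is a unit, so `θ` extends to
`θ' : R[1/y] → k[Y, X'][1/Y]` (`IsLocalization.Away.lift`); `θ'(xᵢ/y) · Y = θ xᵢ = Xᵢ' Y` gives
`θ'(xᵢ/y) = Xᵢ'`, so `θ' ∘ φ` agrees with the localization map of `k[Y, X₁', X₂']` on constants
and variables (`MvPolynomial.ringHom_ext`), and that map is injective (`Y ≠ 0` in a domain). -/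
theorem chartGraphProd_injective {k R : Type*} [Field k] [CommRing R] [Algebra k R] {x₁ x₂ y : R}
    (θ : R →ₐ[k] Localization.Away (MvPolynomial.X 0 : MvPolynomial (Fin 3) k))
    (hθy : θ y = algebraMap (MvPolynomial (Fin 3) k) _ (MvPolynomial.X 0))
    (hθx₁ : θ x₁ = algebraMap (MvPolynomial (Fin 3) k) _ (MvPolynomial.X 1 * MvPolynomial.X 0))
    (hθx₂ : θ x₂ = algebraMap (MvPolynomial (Fin 3) k) _ (MvPolynomial.X 2 * MvPolynomial.X 0))
    (φ : MvPolynomial (Fin 3) k →+* Localization.Away y)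
    (hφC : ∀ c, φ (MvPolynomial.C c) = algebraMap R (Localization.Away y) (algebraMap k R c))
    (hφ0 : φ (MvPolynomial.X 0) = algebraMap R (Localization.Away y) y)
    (hφ1 : φ (MvPolynomial.X 1) =
      algebraMap R (Localization.Away y) x₁ * IsLocalization.Away.invSelf y)
    (hφ2 : φ (MvPolynomial.X 2) =
      algebraMap R (Localization.Away y) x₂ * IsLocalization.Away.invSelf y) :
    Function.Injective φ := by
  set L' := Localization.Away (MvPolynomial.X 0 : MvPolynomial (Fin 3) k)
  have hunit : IsUnit (θ.toRingHom y) := by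
    change IsUnit (θ y)
    rw [hθy]
    exact IsLocalization.Away.algebraMap_isUnit _
  -- the extension `θ'` of `θ` to `R[1/y]` and its values
  have hθ' : ∀ r, IsLocalization.Away.lift (S := Localization.Away y) y hunit
      (algebraMap R (Localization.Away y) r) = θ r :=
    fun r => IsLocalization.Away.lift_eq y hunit r
  have hinv : IsLocalization.Away.lift (S := Localization.Away y) y hunit
      (IsLocalization.Away.invSelf y) * algebraMap (MvPolynomial (Fin 3) k) L' (MvPolynomial.X 0) =
      1 := by
    rw [← hθy, ← hθ' y, ← map_mul, mul_comm, IsLocalization.Away.mul_invSelf, map_one]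
  have hcomp : (IsLocalization.Away.lift (S := Localization.Away y) y hunit).comp φ =
      algebraMap (MvPolynomial (Fin 3) k) L' := by
    refine MvPolynomial.ringHom_ext (fun c => ?_) (fun i => ?_)
    · rw [RingHom.comp_apply, hφC, hθ', AlgHom.commutes,
        IsScalarTower.algebraMap_apply k (MvPolynomial (Fin 3) k) L', MvPolynomial.algebraMap_eq]
    · match i with
      | 0 => rw [RingHom.comp_apply, hφ0, hθ', hθy]
      | 1 =>
        rw [RingHom.comp_apply, hφ1, map_mul, hθ', hθx₁, map_mul, mul_assoc,
          mul_comm (algebraMap _ L' (MvPolynomial.X 0)), hinv, mul_one]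
      | 2 =>
        rw [RingHom.comp_apply, hφ2, map_mul, hθ', hθx₂, map_mul, mul_assoc,
          mul_comm (algebraMap _ L' (MvPolynomial.X 0)), hinv, mul_one]
  refine Function.Injective.of_comp
    (f := IsLocalization.Away.lift (S := Localization.Away y) y hunit) ?_
  rw [← RingHom.coe_comp, hcomp]
  exact IsLocalization.injective L'
    (powers_le_nonZeroDivisors_of_noZeroDivisors (MvPolynomial.X_ne_zero 0))

/-- **GRAPH CHART OF THE CONE OVER `ℙ¹ × ℙ¹`** (registered stub `stub_chart_graph_prod`, worker U2,
crux stmt-ResolutionOfSingularities-15317, line `Sketch`). Let `R` be a `k`-algebra generated by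
`x₁, x₂, y, z` with `yz + x₁x₂ = 0`, admitting a test map `θ : R → k[Y, X₁', X₂'][1/Y]` with
`θ y = Y`, `θ xᵢ = Xᵢ'Y`, `θ z = −X₁'X₂'Y`. Then the affine blowup algebra `R[I/y] ⊆ R[1/y]`,
`I = (x₁, x₂, y, z)`, is a regular ring: the parametrisation `k[Y, X₁', X₂'] → R[I/y]`, `Y ↦ y`,
`Xᵢ' ↦ xᵢ/y`, is surjective (`chartGraphProd_mem_of_mem_blowupAlgebra`,
`chartGraphProd_algebraMap_mem`) and injective (`chartGraphProd_injective`), and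
`k[Y, X₁', X₂']` is regular (Mathlib), transported along `IsRegularRing.of_ringEquiv`. The value
`θ z` (hypothesis `hθz`) is not needed. -/
theorem stub_chart_graph_prod (k R : Type) [Field k] [CommRing R] [Algebra k R] (x₁ x₂ y z : R)
    (hrel : y * z + x₁ * x₂ = 0) (hgen : Algebra.adjoin k {x₁, x₂, y, z} = ⊤)
    (θ : R →ₐ[k] Localization.Away (MvPolynomial.X 0 : MvPolynomial (Fin 3) k))
    (hθy : θ y = algebraMap (MvPolynomial (Fin 3) k) _ (MvPolynomial.X 0))
    (hθx₁ : θ x₁ = algebraMap (MvPolynomial (Fin 3) k) _ (MvPolynomial.X 1 * MvPolynomial.X 0))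
    (hθx₂ : θ x₂ = algebraMap (MvPolynomial (Fin 3) k) _ (MvPolynomial.X 2 * MvPolynomial.X 0))
    (hθz : θ z = -(algebraMap (MvPolynomial (Fin 3) k) _
      (MvPolynomial.X 1 * MvPolynomial.X 2 * MvPolynomial.X 0))) :
    IsRegularRing (blowupAlgebra (Ideal.span {x₁, x₂, y, z}) y) := by
  -- `θ z = −X₁'X₂'Y` is forced by the relation and the other three values: recorded, not used
  have _ := hθz
  have hx₁ : x₁ ∈ Ideal.span {x₁, x₂, y, z} := Ideal.subset_span (by simp)
  have hx₂ : x₂ ∈ Ideal.span {x₁, x₂, y, z} := Ideal.subset_span (by simp)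
  -- the chart parametrisation `ψ : k[Y, X₁', X₂'] → R[I/y]`, `Y ↦ y`, `Xᵢ' ↦ xᵢ/y`
  let ψ : MvPolynomial (Fin 3) k →+* blowupAlgebra (Ideal.span {x₁, x₂, y, z}) y :=
    MvPolynomial.eval₂Hom ((algebraMap R _).comp (algebraMap k R))
      ![algebraMap R _ y, ⟨_, div_mem_blowupAlgebra _ y hx₁⟩, ⟨_, div_mem_blowupAlgebra _ y hx₂⟩]
  -- followed by the inclusion `R[I/y] ⊆ R[1/y]`
  let φ : MvPolynomial (Fin 3) k →+* Localization.Away y :=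
    (blowupAlgebra (Ideal.span {x₁, x₂, y, z}) y).val.toRingHom.comp ψ
  have hφ : ∀ p, φ p = (ψ p : Localization.Away y) := fun p => rfl
  have hφC : ∀ c, φ (MvPolynomial.C c) = algebraMap R (Localization.Away y) (algebraMap k R c) := by
    intro c
    rw [hφ]
    simp only [ψ, MvPolynomial.coe_eval₂Hom, MvPolynomial.eval₂_C, RingHom.comp_apply]
    rfl
  have hφ0 : φ (MvPolynomial.X 0) = algebraMap R (Localization.Away y) y := by
    rw [hφ]
    simp only [ψ, MvPolynomial.coe_eval₂Hom, MvPolynomial.eval₂_X, Matrix.cons_val_zero]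
    rfl
  have hφ1 : φ (MvPolynomial.X 1) =
      algebraMap R (Localization.Away y) x₁ * IsLocalization.Away.invSelf y := by
    rw [hφ]
    simp only [ψ, MvPolynomial.coe_eval₂Hom, MvPolynomial.eval₂_X, Matrix.cons_val_one,
      Matrix.cons_val_zero]
  have hφ2 : φ (MvPolynomial.X 2) =
      algebraMap R (Localization.Away y) x₂ * IsLocalization.Away.invSelf y := by
    rw [hφ]
    simp only [ψ, MvPolynomial.coe_eval₂Hom, MvPolynomial.eval₂_X, Matrix.cons_val_two,
      Matrix.tail_cons, Matrix.head_cons]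
  -- `ψ` is injective (test map) and surjective (generation)
  have hinj : Function.Injective ψ :=
    Function.Injective.of_comp
      (f := (blowupAlgebra (Ideal.span {x₁, x₂, y, z}) y).val.toRingHom)
      (chartGraphProd_injective θ hθy hθx₁ hθx₂ φ hφC hφ0 hφ1 hφ2)
  have hsurj : Function.Surjective ψ := by
    intro b
    have hR : ∀ r, algebraMap R (Localization.Away y) r ∈ φ.range :=
      chartGraphProd_algebraMap_mem hrel hgen φ.range (fun c => ⟨_, hφC c⟩) ⟨_, hφ0⟩ ⟨_, hφ1⟩
        ⟨_, hφ2⟩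
    obtain ⟨p, hp⟩ : (b : Localization.Away y) ∈ φ.range :=
      chartGraphProd_mem_of_mem_blowupAlgebra hrel φ.range hR ⟨_, hφ1⟩ ⟨_, hφ2⟩ b.2
    exact ⟨p, Subtype.ext hp⟩
  -- transport regularity of `k[Y, X₁', X₂']` along the ring isomorphism `ψ`
  exact IsRegularRing.of_ringEquiv (RingEquiv.ofBijective ψ ⟨hinj, hsurj⟩)

end Summit.ResolutionOfSingularities.ResolutionOfSingularities.Theorems.FRationalResolution

end
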